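import Literature.MathematicalPhysics.QuantumFieldTheory.Balaban1983to89.B9Eq326DeltaABlockDecayTower
import Literature.MathematicalPhysics.QuantumFieldTheory.Balaban1983to89.B9Eq349ConjugatedProjectionDifferenceChainTower
import Literature.MathematicalPhysics.QuantumFieldTheory.Balaban1983to89.B9Eq349ConjugatedQTowerLettersCompanion
import Literature.MathematicalPhysics.QuantumFieldTheory.Balaban1983to89.B9Eq325ProjectionDivergenceQuarterKappaTower

/-!
# `Balaban1983to89.B9Eq326DeltaAHQKLettersTower` — T. Bałaban, *Propagators for lattice gauge theories in a background field*, Commun. Math. Phys. **99**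
# (1985) 389–434 [Balaban1985BackgroundPropagators] (3.26) p. 395, (3.15)–(3.19) p. 393, (3.21)∕(3.25) p. 394, (3.49) p. 399, (3.69) p. 404, Thm 3.11 p. 416,
# with [Balaban1985Variational] (110) p. 294: **THE FOUR CONJUGATION LETTERS OF ROAD ΔA-CT INHABITED AT THE TOWER, EVERY HEIGHT `n` — the `hQK` binder
# of ne9-leaf-03's (GBT2) `B9Eq326DeltaABlockDecayTower.norm_block_G1k_le` ∕ (H1DT) ∕ (EH1T) at print's composite averaging `Q_k(U) := QkW`, `Δ′(U)` on
# `T_{L^{n+1}m}` and `R_k(U)`, and THE COROLLARY: the big-block `L²` decay of `G₁,k(U) = Δ_{a,k}(U)⁻¹` with `hQK` and `C_P` DISCHARGED** — the tower twin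
# of gen 94's `B9Eq326DeltaAHQKLetters`: gen 94's `B9Eq349ConjugatedQTowerLettersCompanion` (`dQ`, `dQ′` at `QkW` from ONE cut-off + ONE companion),
# `B9Eq349ConjugatedQLettersCompanion.norm_expConj_curvOp_sub_le` (`dK`, any lattice), ne9-leaf-03's `dR` chain at the tower and tower `C_P` letter

statement-level skeleton of published theorems with citation tags; proofs where landed; nothing here is a claim about the Yang–Mills mass gap

CITATION HEADER (lean-in-tree rule).  Audit cell `pub-balaban`, sub-cell `t4`, BINDER row NE9; filed by the NE9 BINDER-row OWNER lineage
`b2b-balaban-t4-ne9-p1` (gen 94).  Imports ne9-leaf-03's (GBT2) `B9Eq326DeltaABlockDecayTower`, (PDCT) `B9Eq349ConjugatedProjectionDifferenceChainTower`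
(`norm_conjRofUk_sub_RofUk_le_sqrtKappa`), `B9Eq325ProjectionDivergenceQuarterKappaTower` (`norm_one_sub_RofUk_covDivL2K_le_sqrt`) and gen 94's
`B9Eq349ConjugatedQTowerLettersCompanion` (`norm_expConj_QkW_sub_le`, `norm_expConj_adjoint_QkW_sub_le`; through it `B9Eq349ConjugatedQLettersCompanion`,
`B9Eq369CurvFormL2`).  Sources READ first-hand (`paper:balaban1985-cmp99-background-propagators`): p. 395 (3.26), p. 393 (3.15)–(3.19), p. 394 (3.21)∕(3.25),
p. 399 (3.49), p. 404 (3.69), p. 416 Thm 3.11; [Balaban1985Variational] p. 294 (110).  Print's decay proof is the random walk of Sect. C; everything here is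
the ROUTE's Combes–Thomas bookkeeping; no rate or constant of print is asserted; the tower `dQ` constant is the crude product difference of gen 93's
telescoped letter (absorbed by the window `… ≤ β`).

WHAT IS PROVED (sorry-free; proof lane — no `def`; [folklore] composition BY NAME).  The tower `T_{L^{n+1}m} → T_m` (`1 ≤ m_i`, `1 ≤ L`); `𝔸`, fibre `φ`,
weights; background `U` on the finest lattice (`U(b) ∈ U1`, `hRS`, the per-level (3.35)-type letters `α_j`, `hU1`, `hreg` of `UlevOf`, `‖U_j(b) − 1‖ ≤ ε_j`,
plaquette smallness `δ`), trace datum; the `G′_k` side (`a′`, `hpos′`, `γ′`-coercivity, floor `κ₁`, size `M` of `Q̃′_k`).  Radius `r`, CLOSED windows: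
`rℓη ≤ 1`, `r(3ℓ′ + L^{n+1}ℓη) ≤ 1`, `r·2dL^nℓη ≤ 1`, `rℓ′ ≤ 1`, the tower `dQ` window `C_T(r) ≤ β` (gen 93's product difference at the readings
`r_0 = 3ℓ′ + L^{n+1}ℓη`, `r_j = 2dL^{n+1−j}ℓη`), `8rℓη·p_K ≤ β_K`, `2rℓM_φM_φ′√d ≤ β′`, `2rℓ′M ≤ β′`, `β′ ≤ 1`, `3(1+a′)β′² ≤ γ′∕4`, `12s_Aβ′ ≤ √κ₁`,
`15β′s_A∕√κ₁ ≤ ρ`.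
* §1 **`hQK_of_chain_tower`** — (GBT2)'s binder: `∀ χ χ′ (increments ≤ ℓη) (one-BIG-block companion ≤ ℓ′) M_B M_S M_F κ (‖κ‖ = r), dQ(β) ∧ dQ′(β) ∧
  dK(β_K) ∧ dR(ρ)`.
* §2 **`norm_block_G1k_le_closed`** — (GBT2) with `hQK := hQK_of_chain_tower`, the `p_K` floor from g92 (any lattice) and `hP` from the tower `C_P` letter
  (`C_P = √(M∕√κ₁)`): `‖P_{y₁} ∘ G₁,k(U) ∘ P_{y₀}‖ ≤ (4∕γ)·e^{r}·e^{−r·d_m(y₀,y₁)}` AT EVERY HEIGHT given ONLY the Thm-3.11-currency letters, the MODEL letters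
  and the CLOSED windows.
HONEST SCOPE.  Composition; `γ`, `γ′`, `κ₁`, `M`, `hpos`, `hpos′` DISPLAYED; the `dQ` window carries a height-dependent product difference whose height-free
reading is the consumer's arithmetic (`B9Eq349ConjugatedQTowerLettersCompanion.norm_expConj_QkW_sub_le_linear`); nothing of [B9] Thm 3.1∕3.3∕3.11 asserted,
valued or discharged; «NE9 ⇐ the named binders»; NE9 NOT PRINTED ∕ NOT PROVED; row WALLED ON A MODEL (O-NE9-1; #5 UNRULED); spine PROVED 0∕9; rung (B)+1 on
a finite T⁴ — NOT infinite volume, NOT mass gap, NOT BetaPertH, NOT Clay.  HONEST DEPENDENCY: continuum YM on T⁴ ⇐ BetaPertH ∧ nine spine estimates (0/9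
proved); BetaPertH ⇐ (D1) ∧ (D4) ∧ CAP+tail.  NEW file; nothing modified.  Net new unproved facts: 0.
-/

noncomputable section

set_option autoImplicit false

open scoped InnerProductSpace ComplexConjugate BigOperators
open NormedSpace

namespace Literature.MathematicalPhysics.QuantumFieldTheory.Balaban1983to89.B9Eq326DeltaAHQKLettersTower

open B4Sect5Torus (TSite tdist)
open B9SectCLatticeCarrier (Bond DirPair bpos btgt)
open B9Eq311L2Pairing (WL2)
open B9Eq319QprimeTorus (fineP blockCoord mem_blockOf_iff)
open B9Eq315QTower (towerP UlevOf)
open B9Eq315QTorus (perCfg cornerSite)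
open B7Prop1Explicit (U1 Wcx boxVec)
open B9Eq316TowerFlatIsOneStep (siteCast towerP_eq_fineP_pow)
open B11Eq103H1Complex (SiteL2K BondL2K covDerivL2K covDivL2K)
open B9Eq310DeltaPrime (reHol imHol)
open B9Eq310HessianOperator (adTransportW curvOp)
open B9Eq326OperatorTower (laplaceAk RofUk G1k QkW QprimeTowerW)
open B9Eq324DeltaPrimeATower (laplacePrimeAk GpOfUk)
open B9Eq326DeltaABlockDecayTower (norm_block_G1k_le)
open B9Eq349ConjugatedProjectionDifferenceChainTower (norm_conjRofUk_sub_RofUk_le_sqrtKappa)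
open B9Eq349ConjugatedQTowerLettersCompanion (norm_expConj_QkW_sub_le norm_expConj_adjoint_QkW_sub_le)
open B9Eq349ConjugatedQLettersCompanion (norm_expConj_curvOp_sub_le)
open B9Eq369CurvFormL2 (re_inner_curvOp_self_ge)
open B9Eq3101ExpPointwiseMultiplier (equiv_exp_smul_apply_complex equiv_exp_smul_neg_apply_complex)
open B9Eq387IMSLocalLettersLattice (exists_pointwise_clm)

variable {d : ℕ} (L : ℕ) [NeZero L] (m : Fin d → ℕ) [∀ i, NeZero (m i)] (n : ℕ)
  {𝔸 : Type*} [NormedRing 𝔸] [StarRing 𝔸] [NormedAlgebra ℂ 𝔸] [StarModule ℂ 𝔸] [CompleteSpace 𝔸] [NormOneClass 𝔸]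
  {W : Type*} [NormedAddCommGroup W] [InnerProductSpace ℂ W] [FiniteDimensional ℂ W] (φ : W ≃ₗ[ℂ] 𝔸) {Mφ Mφ' : ℝ}
  (hφ : ∀ w, ‖φ w‖ ≤ Mφ * ‖w‖) (hφ' : ∀ X, ‖φ.symm X‖ ≤ Mφ' * ‖X‖) (hMφ : 0 ≤ Mφ) (hMφ' : 0 ≤ Mφ') (hstar : ∀ X : 𝔸, ‖star X‖ ≤ ‖X‖)
  {c₀ : ℝ} [Fact (0 < c₀)] {c₁ : ℝ} [Fact (0 < c₁)] {η : ℝ} (hη : 0 < η) (hηL : η * (L : ℝ) ^ (n + 1) = 1)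
  (U : Bond d (towerP L m (n + 1)) → 𝔸ˣ) (hU : ∀ b, U b ∈ U1 𝔸)
  (hRS : ∀ (b : Bond d (towerP L m (n + 1))) (v u : W), ⟪adTransportW φ U b v, u⟫_ℂ = ⟪v, adTransportW φ (fun b => (U b)⁻¹) b u⟫_ℂ)
  (τ : 𝔸 →ₗ[ℂ] ℂ) {Mτ : ℝ} (hτ : ∀ X Y : 𝔸, ‖τ (X * Y)‖ ≤ Mτ * ‖X‖ * ‖Y‖) (hMτ : 0 ≤ Mτ)
  (hL : 1 ≤ L) (hm : ∀ i, 1 ≤ m i) (α : ℕ → ℝ) (hα1 : ∀ j, α j ≤ 1 / 64)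
  (hU1 : ∀ (j : ℕ) (x : B7Prop1Explicit.Site d) (k : Fin d), perCfg (towerP L m (j + 1)) (UlevOf L m (n + 1) U j) x k ∈ U1 𝔸)
  (hreg : ∀ (j : ℕ) (y : TSite d (towerP L m j)) (k : Fin d) (ρ' : Fin d → Fin L),
    ‖((Wcx L (perCfg (towerP L m (j + 1)) (UlevOf L m (n + 1) U j)) (cornerSite L y) k (boxVec L ρ') : 𝔸ˣ) : 𝔸) - 1‖ ≤ α j)
  (εU : ℕ → ℝ) (hεU : ∀ j, 0 ≤ εU j)
  (hUε : ∀ (j : ℕ) (b : Bond d (towerP L m (j + 1))), ‖(UlevOf L m (n + 1) U j b : 𝔸) - 1‖ ≤ εU j)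
  {δ : ℝ} (hδ : 0 ≤ δ)
  (hRe : ∀ p : B9SectCLatticeCarrier.Plaq d (towerP L m (n + 1)), ‖reHol U p - 1‖ ≤ δ)
  (hIm : ∀ p : B9SectCLatticeCarrier.Plaq d (towerP L m (n + 1)), ‖imHol U p‖ ≤ δ)
  -- the `G′_k` side of the `dR` chain
  {a' : ℝ} (ha' : 0 ≤ a')
  (hpos' : ∀ x : SiteL2K ℂ d (towerP L m (n + 1)) c₀ W, x ≠ 0 → 0 < RCLike.re ⟪x, laplacePrimeAk L m n φ η U a' (c₁ := c₁) x⟫_ℂ)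
  {γ' κ₁ M : ℝ} (hγ' : 0 < γ') (hγ'1 : γ' ≤ 1) (hκ₁ : 0 < κ₁) (hM : 0 ≤ M)
  (coercive : ∀ f : SiteL2K ℂ d (towerP L m (n + 1)) c₀ W, γ' * ‖f‖ ^ 2 ≤ ‖(covDerivL2K ℂ c₀ ((η : ℂ))⁻¹ (adTransportW φ U)) f‖ ^ 2 +
    a' * ‖((WL2.linearEquiv ℂ ℂ (fun _ : TSite d m => c₁)).symm.toLinearMap ∘ₗ QprimeTowerW L m n φ U (c₀ := c₀)) f‖ ^ 2)
  (hκ : ∀ ψ : SiteL2K ℂ d m c₁ W, κ₁ * ‖ψ‖ ^ 2 ≤ RCLike.re ⟪ψ,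
    (((WL2.linearEquiv ℂ ℂ (fun _ : TSite d m => c₁)).symm.toLinearMap ∘ₗ QprimeTowerW L m n φ U (c₀ := c₀)) ∘ₗ
      GpOfUk L m n φ η U a' (c₁ := c₁) hpos' ∘ₗ GpOfUk L m n φ η U a' (c₁ := c₁) hpos' ∘ₗ
      LinearMap.adjoint ((WL2.linearEquiv ℂ ℂ (fun _ : TSite d m => c₁)).symm.toLinearMap ∘ₗ QprimeTowerW L m n φ U (c₀ := c₀))) ψ⟫_ℂ)
  (hMQ : ∀ s : SiteL2K ℂ d (towerP L m (n + 1)) c₀ W,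
    ‖((WL2.linearEquiv ℂ ℂ (fun _ : TSite d m => c₁)).symm.toLinearMap ∘ₗ QprimeTowerW L m n φ U (c₀ := c₀)) s‖ ≤ M * ‖s‖)
  -- the radius and the CLOSED windows
  {r ℓ ℓ' β βK β' ρ : ℝ} (hr : 0 ≤ r) (hℓ : 1 ≤ ℓ) (hℓ' : 1 ≤ ℓ') (hβ'0 : 0 ≤ β') (hβ'1 : β' ≤ 1)
  (hwin : r * ℓ * η ≤ 1) (hwin0 : r * (3 * ℓ' + (L : ℝ) ^ (n + 1) * (ℓ * η)) ≤ 1) (hwin1 : r * (2 * d * (L : ℝ) ^ n * (ℓ * η)) ≤ 1)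
  (hwin' : r * ℓ' ≤ 1)
  (hβT : Mφ' * Mφ * Real.sqrt (c₁ / (c₀ * ((L : ℝ) ^ (n + 1)) ^ d)) *
    ((∏ j ∈ Finset.range (n + 1), (1 + Real.sqrt ((L : ℝ) ^ d) * (Real.sqrt (2 * d) * (102 * (d + 1) ^ 2 * L * εU j) +
        2 * (r * (if j = 0 then 3 * ℓ' + (L : ℝ) ^ (n + 1) * (ℓ * η) else 2 * d * (L : ℝ) ^ (n + 1 - j) * (ℓ * η))) *
          Real.sqrt (2 * (2 * d * (102 * (d + 1) ^ 2 * L * εU j) ^ 2 + ((L : ℝ) ^ d)⁻¹))))) -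
      ∏ j ∈ Finset.range (n + 1), (1 + Real.sqrt ((L : ℝ) ^ d) * (Real.sqrt (2 * d) * (102 * (d + 1) ^ 2 * L * εU j)))) ≤ β)
  (hβK : 8 * (r * (ℓ * η)) * (768 * Fintype.card (DirPair d) * Mτ * Mφ ^ 2 * (‖((η : ℂ)) ^ d‖ / c₀) * ‖((η : ℂ))⁻¹‖ ^ 2 * δ) ≤ βK)
  (hβ'D : 2 * r * ℓ * (Mφ * Mφ') * Real.sqrt d ≤ β') (hβ'Q : 2 * r * ℓ' * M ≤ β')
  (small' : 3 * (1 + a') * β' ^ 2 ≤ γ' / 4) (hwinκ : 12 * (β' * (4 / γ' + M * ((4 / γ') ^ 2 * (3 + a' * (2 * M + 1))))) ≤ Real.sqrt κ₁)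
  (hρ : (6 * (β' * (4 / γ' + M * ((4 / γ') ^ 2 * (3 + a' * (2 * M + 1))))) + 9 * (β' * (4 / γ' + M * ((4 / γ') ^ 2 * (3 + a' * (2 * M + 1)))))) /
    Real.sqrt κ₁ ≤ ρ)

/-! ## §1 The binder `hQK` inhabited at the tower -/

include hφ hφ' hMφ hMφ' hstar hη hU hRS hτ hMτ hm hεU hUε hδ hRe hIm ha' hγ' hγ'1 hκ₁ hM coercive hκ hMQ hℓ hℓ' hβ'0 hβ'1 hwin hwin0 hwin1 hwin' hβT hβK
  hβ'D hβ'Q small' hwinκ hρ in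
/-- **THE `hQK` BINDER OF (GBT2) ∕ (H1DT) ∕ (EH1T) INHABITED AT THE TOWER**: for every fine weight `χ` on `T_{L^{n+1}m}` (increments `≤ ℓη`), one-BIG-block
companion `χ′` (`≤ ℓ′`), multipliers `M_B, M_S, M_F` and `‖κ‖ = r`: `dQ(β) ∧ dQ′(β) ∧ dK(β_K) ∧ dR(ρ)` at `Q := QkW`, `Δ′ := curvOp`, `R := RofUk` — gen 94's tower
companion letters for the first two, `norm_expConj_curvOp_sub_le` for the third, ne9-leaf-03's `norm_conjRofUk_sub_RofUk_le_sqrtKappa` for the fourth.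
[cite: Balaban1985BackgroundPropagators, (3.15)–(3.19) p.393, (3.21) p.394, (3.25) p.394, (3.26) p.395, (3.49) p.399, (3.69) p.404, Thm 3.11 p.416] -/
theorem hQK_of_chain_tower :
    ∀ (χ : TSite d (towerP L m (n + 1)) → ℝ) (χ' : TSite d m → ℝ),
      (∀ b : Bond d (towerP L m (n + 1)), |χ (bpos b) - χ (btgt b)| ≤ ℓ * η) →
      (∀ (y : TSite d m) (x : TSite d (towerP L m (n + 1))),
        siteCast (towerP_eq_fineP_pow L m (n + 1)) x ∈ B9Eq319QprimeTorus.blockOf (L ^ (n + 1)) m y → |χ' y - χ x| ≤ ℓ') →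
      ∀ (MB : BondL2K ℂ d (towerP L m (n + 1)) c₀ W →L[ℂ] BondL2K ℂ d (towerP L m (n + 1)) c₀ W),
      (∀ (g : BondL2K ℂ d (towerP L m (n + 1)) c₀ W) (b : Bond d (towerP L m (n + 1))),
        WL2.equiv ℂ (fun _ : Bond d (towerP L m (n + 1)) => c₀) W (MB g) b =
          (χ (bpos b) : ℂ) • WL2.equiv ℂ (fun _ : Bond d (towerP L m (n + 1)) => c₀) W g b) →
      ∀ (MS : SiteL2K ℂ d (towerP L m (n + 1)) c₀ W →L[ℂ] SiteL2K ℂ d (towerP L m (n + 1)) c₀ W),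
      (∀ (g : SiteL2K ℂ d (towerP L m (n + 1)) c₀ W) (x : TSite d (towerP L m (n + 1))),
        WL2.equiv ℂ (fun _ : TSite d (towerP L m (n + 1)) => c₀) W (MS g) x =
          (χ x : ℂ) • WL2.equiv ℂ (fun _ : TSite d (towerP L m (n + 1)) => c₀) W g x) →
      ∀ (MF : BondL2K ℂ d m c₁ W →L[ℂ] BondL2K ℂ d m c₁ W),
      (∀ (g : BondL2K ℂ d m c₁ W) (b' : Bond d m),
        WL2.equiv ℂ (fun _ : Bond d m => c₁) W (MF g) b' = (χ' (bpos b') : ℂ) • WL2.equiv ℂ (fun _ : Bond d m => c₁) W g b') →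
      ∀ κ : ℂ, ‖κ‖ = r →
      (∀ f, ‖exp (κ • MF) ((QkW L m n φ U hL α hα1 hU1 hreg (c₀ := c₀) (c₁ := c₁)) (exp (κ • (-MB)) f)) -
          (QkW L m n φ U hL α hα1 hU1 hreg (c₀ := c₀) (c₁ := c₁)) f‖ ≤ β * ‖f‖) ∧
      (∀ g, ‖exp (κ • MB) (LinearMap.adjoint (QkW L m n φ U hL α hα1 hU1 hreg (c₀ := c₀) (c₁ := c₁)) (exp (κ • (-MF)) g)) -
          LinearMap.adjoint (QkW L m n φ U hL α hα1 hU1 hreg (c₀ := c₀) (c₁ := c₁)) g‖ ≤ β * ‖g‖) ∧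
      (∀ f, ‖exp (κ • MB) (curvOp φ τ η U (exp (κ • (-MB)) f)) - curvOp φ τ η U f‖ ≤ βK * ‖f‖) ∧
      (∀ s, ‖exp (κ • MS) (RofUk L m n φ η U (c₀ := c₀) (exp (κ • (-MS)) s)) - RofUk L m n φ η U (c₀ := c₀) s‖ ≤ ρ * ‖s‖) := by
  intro χ χ' hχ hχ' MB hMB MS hMS MF hMF κ hκr
  have hℓ0 : 0 ≤ ℓ := zero_le_one.trans hℓ
  have hℓ'0 : 0 ≤ ℓ' := zero_le_one.trans hℓ'
  have hι : 0 ≤ ℓ * η := mul_nonneg hℓ0 hη.le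
  refine ⟨fun f => ?_, fun g => ?_, fun f => ?_, fun s => ?_⟩
  · -- dQ at the tower
    have hw0 : ‖κ‖ * (3 * ℓ' + (L : ℝ) ^ (n + 1) * (ℓ * η)) ≤ 1 := by rw [hκr]; exact hwin0
    have hw1 : ‖κ‖ * (2 * d * (L : ℝ) ^ n * (ℓ * η)) ≤ 1 := by rw [hκr]; exact hwin1
    have h := norm_expConj_QkW_sub_le L m n hL hm φ hMφ hMφ' hφ hφ' (c₀ := c₀) (c₁ := c₁) U α hα1 hU1 hreg εU hεU hUε hι hℓ'0 hχ hχ' hMB hMF hw0 hw1 f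
    rw [hκr] at h
    exact h.trans (mul_le_mul_of_nonneg_right hβT (norm_nonneg _))
  · -- dQ′ at the tower
    have hw0 : ‖κ‖ * (3 * ℓ' + (L : ℝ) ^ (n + 1) * (ℓ * η)) ≤ 1 := by rw [hκr]; exact hwin0
    have hw1 : ‖κ‖ * (2 * d * (L : ℝ) ^ n * (ℓ * η)) ≤ 1 := by rw [hκr]; exact hwin1
    have h := norm_expConj_adjoint_QkW_sub_le L m n hL hm φ hMφ hMφ' hφ hφ' (c₀ := c₀) (c₁ := c₁) U α hα1 hU1 hreg εU hεU hUε hι hℓ'0 hχ hχ' hMB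
      hMF hw0 hw1 g
    rw [hκr] at h
    exact h.trans (mul_le_mul_of_nonneg_right hβT (norm_nonneg _))
  · -- dK on the finest lattice
    have hwinK : ‖κ‖ * (ℓ * η) ≤ 1 := by rw [hκr, ← mul_assoc]; exact hwin
    have h := norm_expConj_curvOp_sub_le φ hφ hMφ hstar τ hτ hMτ η U hU hδ hRe hIm hι hχ hMB hwinK f
    rw [hκr] at h
    exact h.trans (mul_le_mul_of_nonneg_right hβK (norm_nonneg _))
  · -- dR at the tower: the coarse-site multiplier by `χ′` and ne9-leaf-03's chain letter
    obtain ⟨MG, hMG⟩ := exists_pointwise_clm (𝕜 := ℂ) (w := fun _ : TSite d m => c₁) (V := W) (fun y : TSite d m => y) χ'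
    have hwin1' : ‖κ‖ * ℓ * η ≤ 1 := by rw [hκr]; exact hwin
    have hwin2 : ‖κ‖ * ℓ' ≤ 1 := by rw [hκr]; exact hwin'
    have hβ'D' : 2 * ‖κ‖ * ℓ * (Mφ * Mφ') * Real.sqrt d ≤ β' := by rw [hκr]; exact hβ'D
    have hβ'Q' : 2 * ‖κ‖ * ℓ' * M ≤ β' := by rw [hκr]; exact hβ'Q
    have hχ'' : ∀ (y : TSite d m) (x : TSite d (towerP L m (n + 1))),
        blockCoord (L ^ (n + 1)) m (siteCast (towerP_eq_fineP_pow L m (n + 1)) x) = y → |χ' y - χ x| ≤ ℓ' :=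
      fun y x hxy => hχ' y x ((mem_blockOf_iff (L ^ (n + 1)) m y _).mpr hxy)
    have h := norm_conjRofUk_sub_RofUk_le_sqrtKappa (L := L) (m := m) (n := n) hφ hφ' hMφ hMφ' hη hU ha' hRS hpos' hM hMQ hℓ0 hℓ'0 hχ hχ'' hwin1'
      hwin2
      (S := ((exp (κ • MS) : SiteL2K ℂ d (towerP L m (n + 1)) c₀ W →L[ℂ] SiteL2K ℂ d (towerP L m (n + 1)) c₀ W) :
        SiteL2K ℂ d (towerP L m (n + 1)) c₀ W →ₗ[ℂ] SiteL2K ℂ d (towerP L m (n + 1)) c₀ W))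
      (Sinv := ((exp (κ • (-MS)) : SiteL2K ℂ d (towerP L m (n + 1)) c₀ W →L[ℂ] SiteL2K ℂ d (towerP L m (n + 1)) c₀ W) :
        SiteL2K ℂ d (towerP L m (n + 1)) c₀ W →ₗ[ℂ] SiteL2K ℂ d (towerP L m (n + 1)) c₀ W))
      (fun f x => equiv_exp_smul_apply_complex MS χ hMS κ f x) (fun f x => equiv_exp_smul_neg_apply_complex MS χ hMS κ f x)
      (SB := ((exp (κ • MB) : BondL2K ℂ d (towerP L m (n + 1)) c₀ W →L[ℂ] BondL2K ℂ d (towerP L m (n + 1)) c₀ W) :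
        BondL2K ℂ d (towerP L m (n + 1)) c₀ W →ₗ[ℂ] BondL2K ℂ d (towerP L m (n + 1)) c₀ W))
      (SBinv := ((exp (κ • (-MB)) : BondL2K ℂ d (towerP L m (n + 1)) c₀ W →L[ℂ] BondL2K ℂ d (towerP L m (n + 1)) c₀ W) :
        BondL2K ℂ d (towerP L m (n + 1)) c₀ W →ₗ[ℂ] BondL2K ℂ d (towerP L m (n + 1)) c₀ W))
      (fun g b => equiv_exp_smul_apply_complex MB (fun b => χ (bpos b)) hMB κ g b)
      (fun g b => equiv_exp_smul_neg_apply_complex MB (fun b => χ (bpos b)) hMB κ g b)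
      (SG := ((exp (κ • MG) : SiteL2K ℂ d m c₁ W →L[ℂ] SiteL2K ℂ d m c₁ W) : SiteL2K ℂ d m c₁ W →ₗ[ℂ] SiteL2K ℂ d m c₁ W))
      (SGinv := ((exp (κ • (-MG)) : SiteL2K ℂ d m c₁ W →L[ℂ] SiteL2K ℂ d m c₁ W) : SiteL2K ℂ d m c₁ W →ₗ[ℂ] SiteL2K ℂ d m c₁ W))
      (fun g y => equiv_exp_smul_apply_complex MG (fun y => χ' y) hMG κ g y)
      (fun g y => equiv_exp_smul_neg_apply_complex MG (fun y => χ' y) hMG κ g y)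
      hγ' hγ'1 hκ₁ hM hβ'0 hβ'1 coercive hκ hMQ hβ'D' hβ'Q' small' hwinκ s
    simp only [ContinuousLinearMap.coe_coe] at h
    exact h.trans (mul_le_mul_of_nonneg_right hρ (norm_nonneg _))

/-! ## §2 The corollary: the big-block `L²` decay of `G₁,k(U)` with `hQK` and `C_P` discharged -/

include hφ hφ' hMφ hMφ' hstar hη hηL hU hRS hτ hMτ hm hεU hUε hδ hRe hIm ha' hγ' hγ'1 hκ₁ hM coercive hκ hMQ hr hℓ hℓ' hβ'0 hβ'1 hwin hwin0 hwin1 hwin' hβT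
  hβK hβ'D hβ'Q small' hwinκ hρ in
/-- **THE BIG-BLOCK `L²` DECAY OF `G₁,k(U) = Δ_{a,k}(U)⁻¹`, EVERY HEIGHT, CONJUGATION LETTERS AND `C_P` DISCHARGED**: (GBT2) `norm_block_G1k_le` with
`hQK := hQK_of_chain_tower`, the `p_K` floor := g92's `re_inner_curvOp_self_ge` (any lattice), `hP :=` the tower `C_P` letter
`B9Eq325ProjectionDivergenceQuarterKappaTower.norm_one_sub_RofUk_covDivL2K_le_sqrt` (`C_P = √(M∕√κ₁)`).  Displayed: `γ` + `hpos` (Thm 3.11 for `Δ_{a,k}`),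
`γ′, a′, hpos′, κ₁, M` (the `G′_k` side), the MODEL letters, the CLOSED windows (`ρ ≤ 1∕8`, `4rℓM_φM_φ′d√d ≤ β`, `4rℓM_φM_φ′d ≤ β`, `2rℓM_φM_φ′√d ≤ β`,
`p_K∕2 + (21+3a)β² + 4β√(M∕√κ₁) + 2ρ(M∕√κ₁) + β_K ≤ γ∕4`). [cite: Balaban1985BackgroundPropagators, (3.26) p.395, (3.21)–(3.25) p.394, Thm 3.11 p.416, (3.49) p.399;
Balaban1985Variational, (110) p.294] -/
theorem norm_block_G1k_le_closed (a : ℝ) (ha : 0 ≤ a)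
    (hpos : ∀ x : BondL2K ℂ d (towerP L m (n + 1)) c₀ W, x ≠ 0 →
      0 < RCLike.re ⟪x, laplaceAk L m n φ η U hL α hα1 hU1 hreg τ (c₀ := c₀) (c₁ := c₁) a x⟫_ℂ)
    {γ : ℝ} (hγ : 0 < γ) (hβ : 0 ≤ β) (hρ0 : 0 ≤ ρ) (hρ8 : ρ ≤ 1 / 8)
    (hcoer : ∀ f : BondL2K ℂ d (towerP L m (n + 1)) c₀ W, γ * ‖f‖ ^ 2 ≤
      RCLike.re ⟪f, laplaceAk L m n φ η U hL α hα1 hU1 hreg τ (c₀ := c₀) (c₁ := c₁) a f⟫_ℂ)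
    (hβCC : 4 * r * ℓ * (Mφ * Mφ') * (d * Real.sqrt d) ≤ β) (hβC : 4 * r * ℓ * (Mφ * Mφ') * d ≤ β)
    (hβD : 2 * r * ℓ * (Mφ * Mφ') * Real.sqrt d ≤ β)
    (small : (768 * Fintype.card (DirPair d) * Mτ * Mφ ^ 2 * (‖((η : ℂ)) ^ d‖ / c₀) * ‖((η : ℂ))⁻¹‖ ^ 2 * δ) / 2 + (21 + 3 * a) * β ^ 2 +
      4 * β * Real.sqrt (M / Real.sqrt κ₁) + 2 * ρ * (Real.sqrt (M / Real.sqrt κ₁)) ^ 2 + βK ≤ γ / 4)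
    (PB : TSite d m → BondL2K ℂ d (towerP L m (n + 1)) c₀ W →L[ℂ] BondL2K ℂ d (towerP L m (n + 1)) c₀ W)
    (hPB : ∀ (y : TSite d m) (f : BondL2K ℂ d (towerP L m (n + 1)) c₀ W) (b : Bond d (towerP L m (n + 1))),
      WL2.equiv ℂ (fun _ : Bond d (towerP L m (n + 1)) => c₀) W (PB y f) b =
        if blockCoord (L ^ (n + 1)) m (siteCast (towerP_eq_fineP_pow L m (n + 1)) (bpos b)) = y then
          WL2.equiv ℂ (fun _ : Bond d (towerP L m (n + 1)) => c₀) W f b else 0)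
    (y₀ y₁ : TSite d m) :
    ‖PB y₁ ∘L LinearMap.toContinuousLinearMap (G1k L m n φ η U hL α hα1 hU1 hreg τ (c₀ := c₀) (c₁ := c₁) hpos) ∘L PB y₀‖ ≤
      4 / γ * Real.exp r * Real.exp (-(r * tdist m y₀ y₁)) := by
  have hKre : ∀ f : BondL2K ℂ d (towerP L m (n + 1)) c₀ W,
      -((768 * Fintype.card (DirPair d) * Mτ * Mφ ^ 2 * (‖((η : ℂ)) ^ d‖ / c₀) * ‖((η : ℂ))⁻¹‖ ^ 2 * δ) * ‖f‖ ^ 2) ≤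
        RCLike.re ⟪f, curvOp φ τ η U f⟫_ℂ :=
    fun f => re_inner_curvOp_self_ge φ hφ hstar τ hτ hMτ η U (fun b => B7Prop1Explicit.mem_U1.mp (hU b)) hδ hRe hIm f
  exact norm_block_G1k_le φ hφ hφ' hMφ hMφ' hη hηL U hU hRS τ hL α hα1 hU1 hreg a ha hm hpos hγ hβ hℓ hℓ' hr hρ0 hρ8 (by positivity) hcoer hKre hwin
    hβCC hβC hβD
    (hQK_of_chain_tower L m n φ hφ hφ' hMφ hMφ' hstar hη U hU hRS τ hτ hMτ hL hm α hα1 hU1 hreg εU hεU hUε hδ hRe hIm ha' hpos' hγ' hγ'1 hκ₁ hM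
      coercive hκ hMQ hℓ hℓ' hβ'0 hβ'1 hwin hwin0 hwin1 hwin' hβT hβK hβ'D hβ'Q small' hwinκ hρ)
    (B9Eq325ProjectionDivergenceQuarterKappaTower.norm_one_sub_RofUk_covDivL2K_le_sqrt L m n φ c₀ η U c₁ a' hRS hpos' ha' hM hκ₁ hMQ hκ)
    small PB hPB y₀ y₁

end Literature.MathematicalPhysics.QuantumFieldTheory.Balaban1983to89.B9Eq326DeltaAHQKLettersTower

end
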